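import Summits.ABC.ABC.Theorems.ManyPrimeValuationProduct.Negative.CruxConstantDoublyExponential

/-!
# `ManyPrimeValuationProduct` (stmt-ABC-1561), line `unramified-window-census`: the constant of
`stub_midCensus` is at least exponential in `1/ε`

Negative support (drefute seat `refuter-drefute-stmt-ABC-1561-g3-0`, gen 3, 2026-08-16); symbolic version of
`midCensus_constant_at_one_sixth` (`Negative/ConstantBlowup.lean`), on the family `G_k = F((4^k)#, 2)` of
`Negative/CruxConstantDoublyExponential.lean`.

* `midCensus_constant_ge_exp`: for `0 < ε ≤ 1/14`, every `C` for which the `stub_midCensus` inequality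
  `#{p ∥ N : ε log log N < log v_p} · log log N ≤ ε log N + C` holds on the class satisfies `C ≥ 4^{1/ε − 5}`
  (`k = ⌊1/ε⌋ − 2`: the threshold `ε log log N < log 4 ≤ log v_p` holds for every odd `p ≤ 4^k` because
  `log N < 4^{k+2}` and `(k+2) ε ≤ 1`; the census is then `≥ (π(4^k) − 1)(2k − 3) log 2` against
  `ε log N ≤ (6 log 2 + 3 log 4 · 4^k)/(k+2)`, leaving `C ≥ 4^k/8`).

Paper: `log C_mid(ε) ≥ (1 − o(1)) (1/ε) log (1/ε)` with the exponent `j ≍ 1/(2ε)` in `F(M, j)` instead of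
`j = 2` (drefute-0 notes `NegativeNotesStubMidCensus.md` §4, now certified in the weaker form `log C ≥ log 4/ε −
7`).  So no proof of the census stub has `C_ε = exp(o(1/ε))`; the statement itself is ABC-implied and is not
refuted.
-/

noncomputable section

-- `Summit.<Summit>.<Problem>`: for the single-conjunct summit `ABC` the duplicate `ABC.ABC` is mandated.
set_option linter.dupNamespace false

namespace Summit.ABC.ABC.Theorems.ManyPrimeValuationProduct.Negative

open Literature.NumberTheory.EllipticCurves UniqueFactorizationMonoid Real Finset Chebyshev

/-! ## §4 The census constant is exponential in `1/ε` -/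

/-- `log log N (F((4^k)#, 2)) ≥ (2k − 3) log 2` for `k ≥ 7` (`log N ≥ θ(4^k) ≥ 4^k log 2/4 ≥ 2^{2k−3}`).
[folklore] -/
theorem loglog_conductorNorm_two_ge (k : ℕ) (hk : 7 ≤ k) :
    (2 * k - 3) * Real.log 2 ≤
      Real.log (Real.log ((freyCurve (-1) (32 * ((primorial (4 ^ k) : ℕ) : ℤ) ^ 2)).conductorNorm ℤ)) := by
  have hθlo := theta_four_pow_ge k hk
  have hLlo := theta_le_log_conductorNorm_two (4 ^ k)
  have hlow : (2 : ℝ) ^ (2 * k - 3) ≤ (4 : ℝ) ^ k * Real.log 2 / 4 := by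
    have hk3 : 2 * k - 3 + 3 = 2 * k := by omega
    have e1 : (2 : ℝ) ^ (2 * k - 3) * 2 ^ 3 = (4 : ℝ) ^ k := by
      rw [← pow_add, hk3, pow_mul]; norm_num
    have hl2 := Real.log_two_gt_d9
    have hX : (0 : ℝ) < (2 : ℝ) ^ (2 * k - 3) := by positivity
    rw [← e1]
    have : (1 : ℝ) ≤ 2 ^ 3 * Real.log 2 / 4 := by nlinarith
    calc (2 : ℝ) ^ (2 * k - 3) = (2 : ℝ) ^ (2 * k - 3) * 1 := (mul_one _).symm
      _ ≤ (2 : ℝ) ^ (2 * k - 3) * (2 ^ 3 * Real.log 2 / 4) := mul_le_mul_of_nonneg_left this hX.le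
      _ = _ := by ring
  have hpos : (0 : ℝ) < (2 : ℝ) ^ (2 * k - 3) := by positivity
  calc (2 * k - 3 : ℝ) * Real.log 2 = Real.log ((2 : ℝ) ^ (2 * k - 3)) := by
        rw [Real.log_pow]; push_cast [Nat.cast_sub (show 3 ≤ 2 * k by omega)]; ring
    _ ≤ _ := Real.log_le_log hpos (hlow.trans (hθlo.trans hLlo))

/-- Real-arithmetic core of the census asymptotics.  With `a = 4^k ≥ 256 kk²`, `kk = k ≥ 12`,
`(kk + 2) ε ≤ 1`: `a − 4kk − 1 ≤ 2kk · cnt`, `(2kk − 3) L2 ≤ LL`, `L ≤ 6 L2 + 3 L4 a` and the census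
`cnt · LL ≤ ε L + C` force `a/8 ≤ C`. [folklore] -/
theorem census_asymptotic_core {a kk ε L2 L4 cnt LL L C : ℝ} (hkk : 12 ≤ kk) (hε : 0 ≤ ε)
    (hεk : (kk + 2) * ε ≤ 1) (ha : 256 * kk ^ 2 ≤ a)
    (hL2 : 0.6931471803 < L2) (hL2' : L2 < 0.6931471808) (hL4 : L4 = 2 * L2)
    (hcnt : a - 4 * kk - 1 ≤ 2 * kk * cnt) (hLL : (2 * kk - 3) * L2 ≤ LL) (hLLpos : 0 < LL)
    (hL : L ≤ 6 * L2 + 3 * L4 * a) (hL0 : 0 ≤ L) (h : cnt * LL ≤ ε * L + C) : a / 8 ≤ C := by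
  have hkk0 : 0 < kk := by linarith
  have ha' : 3000 * kk ≤ a := by nlinarith
  have hakk : 0 ≤ a - 4 * kk - 1 := by nlinarith
  -- lower bound for `cnt · LL`, multiplied by `2kk`
  have p1 : (a - 4 * kk - 1) * LL ≤ 2 * kk * (cnt * LL) := by nlinarith
  have p2 : (a - 4 * kk - 1) * ((2 * kk - 3) * L2) ≤ (a - 4 * kk - 1) * LL :=
    mul_le_mul_of_nonneg_left hLL hakk
  -- upper bound for `ε L`, multiplied by `2kk`
  have p3 : ε * L ≤ ε * (6 * L2 + 3 * L4 * a) := mul_le_mul_of_nonneg_left hL hε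
  have hstuff : 0 ≤ 6 * L2 + 3 * L4 * a := by nlinarith
  have p4 : 2 * kk * (ε * (6 * L2 + 3 * L4 * a)) ≤ 2 * (6 * L2 + 3 * L4 * a) := by
    have : kk * ε ≤ 1 := by nlinarith
    nlinarith
  -- assemble
  have p5 : 2 * kk * C ≥ (a - 4 * kk - 1) * ((2 * kk - 3) * L2) - 2 * (6 * L2 + 3 * L4 * a) := by
    nlinarith
  have expand : (a - 4 * kk - 1) * ((2 * kk - 3) * L2) - 2 * (6 * L2 + 3 * (2 * L2) * a)
      = L2 * (2 * a * kk - 15 * a - 8 * kk ^ 2 + 10 * kk - 9) := by ring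
  rw [hL4, expand] at p5
  have q1 : 15 * a ≤ 5 / 4 * (a * kk) := by nlinarith
  have q2 : 8 * kk ^ 2 ≤ a / 32 := by nlinarith
  have q3 : a / 32 ≤ a * kk / 384 := by nlinarith
  have hb : 1 / 2 * (a * kk) ≤ 2 * a * kk - 15 * a - 8 * kk ^ 2 + 10 * kk - 9 := by nlinarith
  have hb0 : 0 ≤ 2 * a * kk - 15 * a - 8 * kk ^ 2 + 10 * kk - 9 := by nlinarith
  have hL2b : 0.6931471803 * (2 * a * kk - 15 * a - 8 * kk ^ 2 + 10 * kk - 9)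
      ≤ L2 * (2 * a * kk - 15 * a - 8 * kk ^ 2 + 10 * kk - 9) := mul_le_mul_of_nonneg_right hL2.le hb0
  have p6 : 2 * kk * (a / 8) ≤ 2 * kk * C := by nlinarith
  exact le_of_mul_le_mul_left p6 (by linarith)

/-- **The census constant is at least exponential in `1/ε`.**  For `0 < ε ≤ 1/14`, every `C` for which
the `stub_midCensus` inequality holds on the class at `ε` satisfies `C ≥ 4^{1/ε − 5}`.  Witness:
`F((4^k)#, 2)`, `k = ⌊1/ε⌋ − 2`: the threshold `ε log log N < log 4 ≤ log v_p` holds for all odd `p ≤ 4^k`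
(`log N < 4^{k+2}`), so the census is `≥ (π(4^k) − 1) · (2k − 3) log 2` against `ε log N ≤ (6 log 2 +
3 log 4 · 4^k)/(k+2)`.  (Paper: `log C_mid(ε) ≥ (1 − o(1)) (1/ε) log (1/ε)` with `j ≍ 1/(2ε)`; here `j = 2`.)
[folklore] -/
theorem midCensus_constant_ge_exp (ε : ℝ) (hε : 0 < ε) (hε' : ε ≤ 1 / 14) (C : ℝ)
    (hC : ∀ (W : WeierstrassCurve ℚ) [W.IsElliptic],
      (∀ p : ℕ, p.Prime → p ≠ 2 → ¬ p ^ 2 ∣ W.conductorNorm ℤ) →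
      4 ≤ ((W.conductorNorm ℤ).primeFactors.filter
        (fun p => p ≠ 2 ∧ ¬ p ^ 2 ∣ W.conductorNorm ℤ)).card →
      ((((W.conductorNorm ℤ).primeFactors.filter (fun p => ¬ p ^ 2 ∣ W.conductorNorm ℤ)).filter
          (fun p => ε * Real.log (Real.log (W.conductorNorm ℤ)) <
            Real.log ((W.minimalDiscriminantNorm ℤ).factorization p))).card : ℝ) *
        Real.log (Real.log (W.conductorNorm ℤ)) ≤ ε * Real.log (W.conductorNorm ℤ) + C) :
    (4 : ℝ) ^ (1 / ε - 5) ≤ C := by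
  -- (1) the parameter `k = ⌊1/ε⌋ − 2`
  obtain ⟨K, hK⟩ : ∃ K : ℕ, K = ⌊1 / ε⌋₊ := ⟨_, rfl⟩
  have hx0 : (0 : ℝ) ≤ 1 / ε := by positivity
  have hK_le : (K : ℝ) ≤ 1 / ε := by rw [hK]; exact Nat.floor_le hx0
  have hK_gt : 1 / ε < K + 1 := by rw [hK]; exact Nat.lt_floor_add_one _
  have hK14 : 14 ≤ K := by
    rw [hK]
    refine Nat.le_floor ?_
    rw [le_div_iff₀ hε]
    push_cast
    nlinarith
  obtain ⟨k, hk⟩ : ∃ k : ℕ, k = K - 2 := ⟨_, rfl⟩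
  have hk12 : 12 ≤ k := by omega
  have hkK : (k : ℝ) + 2 = K := by
    have : k + 2 = K := by omega
    exact_mod_cast this
  have hεk : ((k : ℝ) + 2) * ε ≤ 1 := by
    rw [hkK]
    have := (le_div_iff₀ hε).mp hK_le
    linarith
  have hk_gt : 1 / ε < k + 3 := by linarith
  -- (2) the curve `F((4^k)#, 2)`
  obtain ⟨n, hn⟩ : ∃ n : ℕ, n = 4 ^ k := ⟨_, rfl⟩
  have hn11 : 11 ≤ n := by
    rw [hn]; exact le_trans (by norm_num) (Nat.pow_le_pow_right (by norm_num) (show 2 ≤ k by omega))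
  have hM : 1 ≤ primorial n := primorial_pos n
  haveI := family_isElliptic (primorial n) 2 hM
  have h := hC (freyCurve (-1) (32 * ((primorial n : ℕ) : ℤ) ^ 2)) (family_semistable _ 2 hM)
    (family_four_le_card _ 2 hM (by norm_num) (dvd_primorial_1155 n hn11))
  -- (3) the available bounds
  have hNhi := log_conductorNorm_two_lt n
  have hθhi := theta_four_pow_le k
  have hπ := primeCounting_four_pow_ge k (by omega)
  have hLL := loglog_conductorNorm_two_ge k (by omega)
  rw [← hn] at hθhi hπ hLL
  have hl2 := Real.log_two_gt_d9
  have hl2' := Real.log_two_lt_d9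
  have hL4 : Real.log 4 = 2 * Real.log 2 := by
    rw [show (4 : ℝ) = 2 ^ 2 by norm_num, Real.log_pow]; push_cast; ring
  have hkk : (12 : ℝ) ≤ k := by exact_mod_cast hk12
  have ha256 : 256 * (k : ℝ) ^ 2 ≤ (4 : ℝ) ^ k := by
    have h16 := sixteen_mul_le_two_pow k (by omega)
    have h16' : (16 : ℝ) * k ≤ (2 : ℝ) ^ k := by exact_mod_cast h16
    have e : (4 : ℝ) ^ k = ((2 : ℝ) ^ k) ^ 2 := by rw [← pow_mul, mul_comm, pow_mul]; norm_num
    rw [e]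
    nlinarith
  have hL0 : 0 ≤ Real.log ((freyCurve (-1) (32 * ((primorial n : ℕ) : ℤ) ^ 2)).conductorNorm ℤ : ℝ) :=
    Real.log_natCast_nonneg _
  have hN' : Real.log ((freyCurve (-1) (32 * ((primorial n : ℕ) : ℤ) ^ 2)).conductorNorm ℤ : ℝ)
      ≤ 6 * Real.log 2 + 3 * Real.log 4 * (4 : ℝ) ^ k := by nlinarith
  have hLLpos : 0 < Real.log (Real.log ((freyCurve (-1) (32 * ((primorial n : ℕ) : ℤ) ^ 2)).conductorNorm ℤ : ℝ)) := by
    have : (0 : ℝ) < (2 * k - 3) * Real.log 2 := by nlinarith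
    linarith
  -- (4) the threshold: `ε log log N < log 4`, so every odd prime `≤ n` is counted
  have hthr : ε * Real.log (Real.log ((freyCurve (-1) (32 * ((primorial n : ℕ) : ℤ) ^ 2)).conductorNorm ℤ : ℝ))
      < Real.log 4 := by
    -- `log N < 16 · 4^k ≤ 4^{k+2}` hence `log log N < (k+2) log 4`
    have ha1 : (1 : ℝ) ≤ (4 : ℝ) ^ k := one_le_pow₀ (by norm_num)
    have hLt : Real.log ((freyCurve (-1) (32 * ((primorial n : ℕ) : ℤ) ^ 2)).conductorNorm ℤ : ℝ)
        < (4 : ℝ) ^ (k + 2) := by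
      rw [pow_add]; nlinarith
    have hLpos : 0 < Real.log ((freyCurve (-1) (32 * ((primorial n : ℕ) : ℤ) ^ 2)).conductorNorm ℤ : ℝ) := by
      by_contra hle
      push Not at hle
      have : Real.log ((freyCurve (-1) (32 * ((primorial n : ℕ) : ℤ) ^ 2)).conductorNorm ℤ : ℝ) = 0 :=
        le_antisymm hle hL0
      rw [this, Real.log_zero] at hLLpos
      exact lt_irrefl _ hLLpos
    have hLLt : Real.log (Real.log ((freyCurve (-1) (32 * ((primorial n : ℕ) : ℤ) ^ 2)).conductorNorm ℤ : ℝ))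
        < (k + 2) * Real.log 4 := by
      have := Real.log_lt_log hLpos hLt
      rw [Real.log_pow] at this
      push_cast at this
      exact this
    have h4pos : 0 < Real.log 4 := Real.log_pos (by norm_num)
    calc ε * Real.log (Real.log ((freyCurve (-1) (32 * ((primorial n : ℕ) : ℤ) ^ 2)).conductorNorm ℤ : ℝ))
        < ε * ((k + 2) * Real.log 4) := mul_lt_mul_of_pos_left hLLt hε
      _ = ((k : ℝ) + 2) * ε * Real.log 4 := by ring
      _ ≤ 1 * Real.log 4 := mul_le_mul_of_nonneg_right hεk h4pos.le
      _ = Real.log 4 := one_mul _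
  have hcard := family_card_le (primorial n) 2 hM (by norm_num) ((Nat.primesLE n).filter (· ≠ 2))
    (oddPrimesLE_spec n)
    (fun p => ε * Real.log (Real.log ((freyCurve (-1) (32 * ((primorial n : ℕ) : ℤ) ^ 2)).conductorNorm ℤ)) <
      Real.log (((freyCurve (-1) (32 * ((primorial n : ℕ) : ℤ) ^ 2)).minimalDiscriminantNorm ℤ).factorization p))
    (fun p _ hv => by
      have h4 : (4 : ℝ) ≤ ((((freyCurve (-1) (32 * ((primorial n : ℕ) : ℤ) ^ 2)).minimalDiscriminantNorm
          ℤ).factorization p : ℕ) : ℝ) := by exact_mod_cast hv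
      have hlog4 := Real.log_le_log (by norm_num) h4
      exact lt_of_lt_of_le hthr hlog4)
  rw [card_oddPrimesLE n (by omega)] at hcard
  have h1π : 1 ≤ Nat.primeCounting n := by
    rw [← Nat.primesLE_card_eq_primeCounting]
    exact Finset.card_pos.mpr ⟨2, Nat.mem_primesLE.mpr ⟨by omega, Nat.prime_two⟩⟩
  have hcnt : (Nat.primeCounting n : ℝ) - 1 ≤
      ((((freyCurve (-1) (32 * ((primorial n : ℕ) : ℤ) ^ 2)).conductorNorm ℤ).primeFactors.filter
        (fun p => ¬ p ^ 2 ∣ (freyCurve (-1) (32 * ((primorial n : ℕ) : ℤ) ^ 2)).conductorNorm ℤ)).filter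
        (fun p => ε * Real.log (Real.log ((freyCurve (-1) (32 * ((primorial n : ℕ) : ℤ) ^ 2)).conductorNorm ℤ)) <
          Real.log (((freyCurve (-1) (32 * ((primorial n : ℕ) : ℤ) ^ 2)).minimalDiscriminantNorm
            ℤ).factorization p))).card := by
    have := (Nat.cast_le (α := ℝ)).mpr hcard
    rw [Nat.cast_sub h1π, Nat.cast_one] at this
    exact this
  have hk0 : (0 : ℝ) < k := by linarith
  have hcnt' : (4 : ℝ) ^ k - 4 * k - 1 ≤ 2 * k *
      (((((freyCurve (-1) (32 * ((primorial n : ℕ) : ℤ) ^ 2)).conductorNorm ℤ).primeFactors.filter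
        (fun p => ¬ p ^ 2 ∣ (freyCurve (-1) (32 * ((primorial n : ℕ) : ℤ) ^ 2)).conductorNorm ℤ)).filter
        (fun p => ε * Real.log (Real.log ((freyCurve (-1) (32 * ((primorial n : ℕ) : ℤ) ^ 2)).conductorNorm ℤ)) <
          Real.log (((freyCurve (-1) (32 * ((primorial n : ℕ) : ℤ) ^ 2)).minimalDiscriminantNorm
            ℤ).factorization p))).card : ℝ) := by
    have := (div_le_iff₀ (by positivity : (0 : ℝ) < 2 * k)).mp (hπ.trans hcnt)
    linarith
  -- (5) the core, then `4^{1/ε − 5} ≤ 4^{k−2} = 4^k/16 ≤ 4^k/8 ≤ C`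
  have hcore := census_asymptotic_core hkk hε.le hεk ha256 hl2 hl2' hL4 hcnt' hLL hLLpos hN' hL0 h
  have hexp : (4 : ℝ) ^ (1 / ε - 5) ≤ (4 : ℝ) ^ ((k : ℝ) - 2) :=
    Real.rpow_le_rpow_of_exponent_le (by norm_num) (by linarith)
  have heq : (4 : ℝ) ^ ((k : ℝ) - 2) = (4 : ℝ) ^ k / 16 := by
    rw [Real.rpow_sub (by norm_num), Real.rpow_natCast]; norm_num
  rw [heq] at hexp
  have ha0 : (0 : ℝ) ≤ (4 : ℝ) ^ k := by positivity
  linarith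

end Summit.ABC.ABC.Theorems.ManyPrimeValuationProduct.Negative
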